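import Literature.AnabelianGeometry.EtaleTheta.DivisorMonoidsProofs
import Literature.AnabelianGeometry.EtaleTheta.Discharge.Sec3Lemma35Rlf

/-!
# [EtTh] §3: Lemma 3.5 (i), (ii) — the named facts discharged for the tree's [FrdI] vocabulary

Mochizuki, *The étale theta function …*, Publ. RIMS **45** (2009), §3, Lemma 3.5, PRIMS PDF p. 75
(printed 301) [cite: MochizukiEtTh2009, Lem 3.5 p.75]. The statement file `DivisorMonoids.lean`
(seat abc-iut-L2-t3) records Lemma 3.5 (i), (ii) as the named facts `Lemma35_i V`, `Lemma35_ii V`;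
`FrdIVocabulary.lean` (same seat) fixes the canonical vocabulary `treeMonoidVocab`. This file turns
both named facts, read with `treeMonoidVocab`, into THEOREMS, by combining
* the `P^pf` portion and the reduction to the `P^rlf` clause (`DivisorMonoidsProofs.lean`,
  `SubmonoidPerfection.lean`; seat abc-iut-L6-t12), and
* the `P^rlf` portion (`Discharge/Sec3Lemma35Rlf.lean` with its chain `RealificationCoordinates` →
  `RSupportedMonoids`/`RealificationOrder` → `RealificationExtension`, `PerfectionPrimes`; seat
  abc-iut-L2-d2: `Lemma35.rlf_extension_via`, `Lemma35.isGroupSaturated_rlf_extension_via`).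
No residual hypothesis; no definitions. Seat abc-iut-L6-t12 (unit W2-L2-09), glue agreed with
abc-iut-L2-d2 (cell INBOX 2026-08-25 19:51Z / L2-lead 19:56Z).
-/

namespace Literature.AnabelianGeometry.EtaleTheta

open Literature.AlgebraicGeometry.Frobenioids

universe w

/-- **[EtTh] Lemma 3.5 (i) — discharged** (p. 75): "The inclusion `P ↪ Q` extends uniquely to
inclusions `P^pf ↪ Q`, `P^rlf ↪ Q`" for perf-factorial `P ⊆ Q` with `P` group-saturated in `Q` and
`ℝ` supporting `Q` — the named fact `Lemma35_i` at the tree's vocabulary `treeMonoidVocab` holds.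
[cite: MochizukiEtTh2009, Lem 3.5 p.75] -/
theorem Lemma35_i_holds : Lemma35_i treeMonoidVocab.{w} :=
  Lemma35_i_of_rlf fun _Q _ P _hP _hQ hsat hR R _ ρ hρ => by
    obtain ⟨h, e, he⟩ := hρ
    exact Lemma35.rlf_extension_via P h hsat hR R ρ e he

/-- **[EtTh] Lemma 3.5 (ii) — discharged** (p. 75): "Relative to the inclusions of (i), `P^pf`, `P^rlf`
are group-saturated in `Q`" — the named fact `Lemma35_ii` at `treeMonoidVocab` holds.
[cite: MochizukiEtTh2009, Lem 3.5 p.75] -/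
theorem Lemma35_ii_holds : Lemma35_ii treeMonoidVocab.{w} :=
  Lemma35_ii_of_rlf fun _Q _ P _hP _hQ hsat hR R _ ρ hρ ι hι => by
    obtain ⟨h, e, he⟩ := hρ
    exact Lemma35.isGroupSaturated_rlf_extension_via P h hsat hR R ρ e he ι hι

end Literature.AnabelianGeometry.EtaleTheta
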